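import Mathlib
import Summits.Ventures.PercRepro2.Inst8Embed
import Summits.Ventures.PercRepro2.S4NamedCert

/-!
# S4's other named objects, literally: the typed bases on their own vertex and edge types
(blind cell PercRepro2, typer-1 g14)

The padded instances of `S4NamedCert.lean` embed the named objects (`Inst8Embed.Embed`, vertex and edge
maps `Fin.castLE`), so the typed bases transfer (`typedBases_of_cert_embed`) to the graphs themselves:
the `(6, 7)` target on six vertices and seven edges (`tgt67Graph`), `Θ(o, b; a₁, a₂, u)` + `a₃` pendant
(`thetaPendGraph`, six vertices, seven edges) and the 5-cycle + `a₃` pendant (`c5PendGraph`, six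
vertices, six edges) — `CovForm.TypedBases` and (HCOV) for every admissible weight vector on each.
-/

namespace Summit.Ventures.PercRepro2

namespace Inst8

/-- The `(6, 7)` target itself: `oa₁, oa₂, oa₃, a₁b, a₂u, a₃u, bu` on `o=0 a₁=1 a₂=2 a₃=3 b=4 u=5`. -/
def tgt67Graph : Fin 7 → Sym2 (Fin 6) :=
  ![s(0, 1), s(0, 2), s(0, 3), s(1, 4), s(2, 5), s(3, 5), s(4, 5)]

/-- `Θ(o, b; a₁, a₂, u)` + `a₃` pendant itself: `oa₁, a₁b, oa₂, a₂b, ou, ub, ua₃`. -/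
def thetaPendGraph : Fin 7 → Sym2 (Fin 6) :=
  ![s(0, 1), s(1, 4), s(0, 2), s(2, 4), s(0, 5), s(5, 4), s(5, 3)]

/-- The 5-cycle + `a₃` pendant itself: `a₁o, ob, ba₂, a₂u, ua₁, ua₃`. -/
def c5PendGraph : Fin 6 → Sym2 (Fin 6) :=
  ![s(1, 0), s(0, 4), s(4, 2), s(2, 5), s(5, 1), s(5, 3)]

/-- The `(6, 7)` target embeds in its padded instance. -/
def tgt67Embed : Embed tgt67 tgt67Graph where
  ν := Fin.castLE (by norm_num)
  ι := Fin.castLE (by norm_num)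
  ν_inj := Fin.castLE_injective _
  ι_inj := Fin.castLE_injective _
  ends_eq := by decide
  off := by decide

/-- `Θ` + pendant embeds in its padded instance. -/
def thetaPendEmbed : Embed thetaPend thetaPendGraph where
  ν := Fin.castLE (by norm_num)
  ι := Fin.castLE (by norm_num)
  ν_inj := Fin.castLE_injective _
  ι_inj := Fin.castLE_injective _
  ends_eq := by decide
  off := by decide

/-- The 5-cycle + pendant embeds in its padded instance. -/
def c5PendEmbed : Embed c5Pend c5PendGraph where
  ν := Fin.castLE (by norm_num)
  ι := Fin.castLE (by norm_num)
  ν_inj := Fin.castLE_injective _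
  ι_inj := Fin.castLE_injective _
  ends_eq := by decide
  off := by decide

section Theorems

variable {R : Type*} [Field R] [LinearOrder R] [IsStrictOrderedRing R]

/-- **Row 2′TRI on the `(6, 7)` target itself.** -/
theorem typedBases_tgt67Graph : CovForm.TypedBases (R := R) tgt67Graph 0 1 2 3 4 :=
  typedBases_of_cert_embed tgt67Embed 4 cert_tgt67 0 1 2 3 4 rfl rfl rfl
    rfl rfl

/-- **(HCOV) on the `(6, 7)` target itself** for every admissible weight vector. -/
theorem HCov_tgt67Graph (p : Fin 7 → R) (hp : IsProbVec p) : CovForm.HCov p tgt67Graph 0 1 2 3 4 :=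
  CovForm.HCov_of_typedBases tgt67Graph 0 1 2 3 4 typedBases_tgt67Graph p hp

/-- **Row 2′TRI on `Θ(o, b; a₁, a₂, u)` + `a₃` pendant itself.** -/
theorem typedBases_thetaPendGraph : CovForm.TypedBases (R := R) thetaPendGraph 0 1 2 3 4 :=
  typedBases_of_cert_embed thetaPendEmbed 4 cert_thetaPend 0 1 2 3 4 rfl rfl rfl
    rfl rfl

/-- **(HCOV) on `Θ` + `a₃` pendant itself** for every admissible weight vector. -/
theorem HCov_thetaPendGraph (p : Fin 7 → R) (hp : IsProbVec p) :
    CovForm.HCov p thetaPendGraph 0 1 2 3 4 :=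
  CovForm.HCov_of_typedBases thetaPendGraph 0 1 2 3 4 typedBases_thetaPendGraph p hp

/-- **Row 2′TRI on the 5-cycle + `a₃` pendant itself.** -/
theorem typedBases_c5PendGraph : CovForm.TypedBases (R := R) c5PendGraph 0 1 2 3 4 :=
  typedBases_of_cert_embed c5PendEmbed 4 cert_c5Pend 0 1 2 3 4 rfl rfl rfl
    rfl rfl

/-- **(HCOV) on the 5-cycle + `a₃` pendant itself** for every admissible weight vector. -/
theorem HCov_c5PendGraph (p : Fin 6 → R) (hp : IsProbVec p) : CovForm.HCov p c5PendGraph 0 1 2 3 4 :=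
  CovForm.HCov_of_typedBases c5PendGraph 0 1 2 3 4 typedBases_c5PendGraph p hp

end Theorems

end Inst8

end Summit.Ventures.PercRepro2
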